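import Mathlib
import Literature.Computability.AlgebraicComplexity.LinSubst

/-!
# Binary forms under upper triangular substitutions: coefficient law and the Tschirnhaus normal form
(helper file for the explicit highest-weight-vector axis of `stub_seedRichness`, crux
`ValuativeGCT.ValuativeFlip`, stmt-ValiantsHypothesis-12624)

Elementary bookkeeping for a binary form `q = ∑_i α_i y^i x^m⁻ⁱ ∈ K[y, x]` (`y = X 0 < x = X 1`, the
LAST TWO letters of a lexicographic alphabet after restriction) of degree `m` under the linear
substitutions `linSubst (Fin 2) K B` of the tree (`X i ↦ ∑ j, B j i • X j`) by UPPER TRIANGULAR `B`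
(`B 1 0 = 0`: `y ↦ B₀₀ y`, `x ↦ B₀₁ y + B₁₁ x`):

* `bs_coeff_linSubst` — the **coefficient law**
  `α_r(B · q) = ∑_{i ≤ r} C(m-i, r-i) B₀₀ⁱ B₀₁^{r-i} B₁₁^{m-r} α_i(q)`, with its diagonal, shear and
  `r = 0, 1` specialisations;
* `bs_shear_mul` — the matrix identity `Sh((B₀₁ + B₀₀ t)/B₁₁) · B = diag(B₀₀, B₁₁) · Sh(t)` for the
  shear `Sh(t) : x ↦ x - t y`, whence the **covariance of the Tschirnhaus normal form**
  `N(q) = Sh(α₁/(m α₀)) · q` (the shear killing the second coefficient): `N(B · q) = diag(B₀₀, B₁₁) · N(q)`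
  (`bs_normalForm_linSubst`);
* `bs_tsch_linSubst` — for the **Tschirnhaus polynomials**
  `T_r(q) = ∑_{i ≤ r} C(m-i, r-i) (-α₁)^{r-i} (m α₀)ⁱ α_i = (m α₀)^r α_r(N q)` (`bs_tsch_eq`), the relative
  invariance `T_r(B · q) = B₁₁^{(m-1) r + m} B₀₀^r T_r(q)` whenever `α₀(q) ≠ 0`: the classical
  seminvariants ("protomorphs") of binary forms, Elliott, *Algebra of Quantics* (1895) §§126–130;
  Hilbert, *Theory of Algebraic Invariants*, Lecture I.8; Olver, *Classical Invariant Theory* Ch. 5.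

No definitions and no notation. Everything is over an arbitrary field `K`; `α_r(q)` is written
`coeff (Finsupp.single 0 r + Finsupp.single 1 (m - r)) q` throughout.
-/

set_option linter.dupNamespace false

namespace Summit.ValiantsHypothesis.ValiantsHypothesis.Theorems.ValuativeFlip

open MvPolynomial Literature.Computability.AlgebraicComplexity
open scoped BigOperators

noncomputable section

variable {K : Type*} [Field K]

/-! ## Exponent bookkeeping in two letters -/

/-- Two-letter exponent vectors are determined by their two entries. [folklore] -/
theorem bs_single_add_single_inj (a b a' b' : ℕ) :
    (Finsupp.single (0 : Fin 2) a + Finsupp.single (1 : Fin 2) b : Fin 2 →₀ ℕ) =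
      Finsupp.single 0 a' + Finsupp.single 1 b' ↔ a = a' ∧ b = b' := by
  constructor
  · intro h
    have h0 := congrArg (fun e => e 0) h
    have h1 := congrArg (fun e => e 1) h
    simp only [Finsupp.coe_add, Pi.add_apply, Finsupp.single_apply] at h0 h1
    simp at h0 h1
    exact ⟨h0, h1⟩
  · rintro ⟨rfl, rfl⟩
    rfl

/-- The monomial `y^a x^b`. [folklore] -/
theorem bs_X_pow_mul_X_pow (a b : ℕ) :
    (X 0 ^ a * X 1 ^ b : MvPolynomial (Fin 2) K) =
      monomial (Finsupp.single 0 a + Finsupp.single 1 b) 1 := by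
  rw [X_pow_eq_monomial, X_pow_eq_monomial, monomial_mul, one_mul]

/-- Coefficients of `c · y^a x^b`. [folklore] -/
theorem bs_coeff_C_mul_X_pow_mul_X_pow (c : K) (a b r s : ℕ) :
    coeff (Finsupp.single 0 r + Finsupp.single 1 s) (C c * (X 0 ^ a * X 1 ^ b) : MvPolynomial (Fin 2) K) =
      if a = r ∧ b = s then c else 0 := by
  rw [bs_X_pow_mul_X_pow, C_mul_monomial, mul_one, coeff_monomial]
  simp only [bs_single_add_single_inj]

/-! ## Expansion of a binary form -/

/-- **A binary form is the sum of its `m + 1` coefficients**: for `q` homogeneous of degree `m`,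
`q = ∑_{i=0}^{m} α_i(q) y^i x^{m-i}`. [folklore] -/
theorem bs_expansion {m : ℕ} {q : MvPolynomial (Fin 2) K} (hq : q.IsHomogeneous m) :
    q = ∑ i ∈ Finset.range (m + 1), C (coeff (Finsupp.single 0 i + Finsupp.single 1 (m - i)) q) * (X 0 ^ i * X 1 ^ (m - i)) := by
  ext e
  have hee : e = Finsupp.single 0 (e 0) + Finsupp.single 1 (e 1) := by
    ext j
    fin_cases j <;> simp
  rw [hee, coeff_sum]
  simp only [bs_coeff_C_mul_X_pow_mul_X_pow]
  by_cases he : e 0 + e 1 = m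
  · rw [Finset.sum_eq_single (e 0)]
    · rw [if_pos ⟨rfl, by omega⟩, show m - e 0 = e 1 by omega]
    · intro i _ hi
      rw [if_neg]
      omega
    · intro h
      exfalso
      apply h
      rw [Finset.mem_range]
      omega
  · have hdeg : (Finsupp.single (0 : Fin 2) (e 0) + Finsupp.single (1 : Fin 2) (e 1)).degree ≠ m := by
      rw [Finsupp.degree_eq_sum, Fin.sum_univ_two]
      simpa using he
    rw [hq.coeff_eq_zero hdeg]
    symm
    refine Finset.sum_eq_zero fun i hi => ?_
    rw [Finset.mem_range] at hi
    rw [if_neg]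
    omega

/-! ## The coefficient law under upper triangular substitutions -/

/-- An upper triangular `2 × 2` substitution on a monomial:
`B · (y^i x^j) = (B₀₀ y)^i (B₀₁ y + B₁₁ x)^j = ∑_l C(j,l) B₀₀ⁱ B₀₁ˡ B₁₁^{j-l} y^{i+l} x^{j-l}`. [folklore] -/
theorem bs_linSubst_monomial (B : Matrix (Fin 2) (Fin 2) K) (hB : B 1 0 = 0) (i j : ℕ) :
    linSubst (Fin 2) K B (X 0 ^ i * X 1 ^ j) =
      ∑ l ∈ Finset.range (j + 1), C (B 0 0 ^ i * B 0 1 ^ l * B 1 1 ^ (j - l) * (j.choose l : K)) *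
        (X 0 ^ (i + l) * X 1 ^ (j - l)) := by
  have h0 : linSubst (Fin 2) K B (X 0) = C (B 0 0) * X 0 := by
    rw [linSubst_X, Fin.sum_univ_two, hB, zero_smul, add_zero, smul_eq_C_mul]
  have h1 : linSubst (Fin 2) K B (X 1) = C (B 0 1) * X 0 + C (B 1 1) * X 1 := by
    rw [linSubst_X, Fin.sum_univ_two, smul_eq_C_mul, smul_eq_C_mul]
  rw [map_mul, map_pow, map_pow, h0, h1, add_pow, Finset.mul_sum]
  refine Finset.sum_congr rfl fun l _ => ?_
  simp only [map_mul, map_pow, map_natCast]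
  ring

/-- Coefficients of an upper triangular substitution on a monomial of degree `m`:
`α_r(B · y^i x^{m-i}) = [i ≤ r] C(m-i, r-i) B₀₀ⁱ B₀₁^{r-i} B₁₁^{m-r}`. [folklore] -/
theorem bs_coeff_linSubst_monomial (B : Matrix (Fin 2) (Fin 2) K) (hB : B 1 0 = 0) {m i r : ℕ}
    (hi : i ≤ m) (hr : r ≤ m) :
    coeff (Finsupp.single 0 r + Finsupp.single 1 (m - r)) (linSubst (Fin 2) K B (X 0 ^ i * X 1 ^ (m - i))) =
      if i ≤ r then ((m - i).choose (r - i) : K) * B 0 0 ^ i * B 0 1 ^ (r - i) * B 1 1 ^ (m - r)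
      else 0 := by
  rw [bs_linSubst_monomial B hB, coeff_sum]
  simp only [bs_coeff_C_mul_X_pow_mul_X_pow]
  by_cases hir : i ≤ r
  · rw [if_pos hir, Finset.sum_eq_single (r - i)]
    · rw [if_pos (by omega)]
      have : m - i - (r - i) = m - r := by omega
      rw [this]
      ring
    · intro l _ hl
      rw [if_neg]
      omega
    · intro h
      exfalso; apply h
      rw [Finset.mem_range]; omega
  · rw [if_neg hir]
    refine Finset.sum_eq_zero fun l _ => ?_
    rw [if_neg]
    omega

/-- **Coefficient law.** For `q` homogeneous of degree `m` and `B` upper triangular,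
`α_r(B · q) = ∑_{i=0}^{r} C(m-i, r-i) B₀₀ⁱ B₀₁^{r-i} B₁₁^{m-r} α_i(q)` (`r ≤ m`). [folklore] -/
theorem bs_coeff_linSubst (B : Matrix (Fin 2) (Fin 2) K) (hB : B 1 0 = 0) {m : ℕ}
    {q : MvPolynomial (Fin 2) K} (hq : q.IsHomogeneous m) {r : ℕ} (hr : r ≤ m) :
    coeff (Finsupp.single 0 r + Finsupp.single 1 (m - r)) (linSubst (Fin 2) K B q) =
      ∑ i ∈ Finset.range (r + 1), ((m - i).choose (r - i) : K) * B 0 0 ^ i * B 0 1 ^ (r - i) *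
        B 1 1 ^ (m - r) * coeff (Finsupp.single 0 i + Finsupp.single 1 (m - i)) q := by
  conv_lhs => rw [bs_expansion hq, map_sum, coeff_sum]
  have hterm : ∀ i ∈ Finset.range (m + 1),
      coeff (Finsupp.single 0 r + Finsupp.single 1 (m - r)) (linSubst (Fin 2) K B (C (coeff (Finsupp.single 0 i + Finsupp.single 1 (m - i)) q) * (X 0 ^ i * X 1 ^ (m - i)))) =
        if i ≤ r then ((m - i).choose (r - i) : K) * B 0 0 ^ i * B 0 1 ^ (r - i) *
          B 1 1 ^ (m - r) * coeff (Finsupp.single 0 i + Finsupp.single 1 (m - i)) q else 0 := by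
    intro i hi
    rw [Finset.mem_range] at hi
    rw [map_mul, linSubst_C, coeff_C_mul, bs_coeff_linSubst_monomial B hB (by omega) hr]
    split_ifs <;> ring
  rw [Finset.sum_congr rfl hterm, ← Finset.sum_filter]
  congr 1
  ext i
  simp only [Finset.mem_filter, Finset.mem_range]
  omega

/-- Coefficient law, `r = 0`: `α₀(B · q) = B₁₁^m α₀(q)`. [folklore] -/
theorem bs_coeff_zero_linSubst (B : Matrix (Fin 2) (Fin 2) K) (hB : B 1 0 = 0) {m : ℕ}
    {q : MvPolynomial (Fin 2) K} (hq : q.IsHomogeneous m) :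
    coeff (Finsupp.single 0 0 + Finsupp.single 1 (m - 0)) (linSubst (Fin 2) K B q) = B 1 1 ^ m * coeff (Finsupp.single 0 0 + Finsupp.single 1 (m - 0)) q := by
  rw [bs_coeff_linSubst B hB hq (Nat.zero_le m), Finset.sum_range_one]
  simp

/-- Coefficient law, `r = 1`: `α₁(B · q) = m B₀₁ B₁₁^{m-1} α₀(q) + B₀₀ B₁₁^{m-1} α₁(q)` (`1 ≤ m`).
[folklore] -/
theorem bs_coeff_one_linSubst (B : Matrix (Fin 2) (Fin 2) K) (hB : B 1 0 = 0) {m : ℕ}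
    {q : MvPolynomial (Fin 2) K} (hq : q.IsHomogeneous m) (hm : 1 ≤ m) :
    coeff (Finsupp.single 0 1 + Finsupp.single 1 (m - 1)) (linSubst (Fin 2) K B q) =
      (m : K) * B 0 1 * B 1 1 ^ (m - 1) * coeff (Finsupp.single 0 0 + Finsupp.single 1 (m - 0)) q + B 0 0 * B 1 1 ^ (m - 1) * coeff (Finsupp.single 0 1 + Finsupp.single 1 (m - 1)) q := by
  rw [bs_coeff_linSubst B hB hq hm, Finset.sum_range_succ, Finset.sum_range_one]
  simp only [Nat.sub_zero, Nat.choose_one_right, pow_zero, pow_one, Nat.sub_self, Nat.choose_zero_right,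
    Nat.cast_one, mul_one, one_mul]

/-- Coefficient law for a DIAGONAL substitution: `α_r(diag(B₀₀, B₁₁) · q) = B₀₀^r B₁₁^{m-r} α_r(q)`.
[folklore] -/
theorem bs_coeff_linSubst_of_diag (B : Matrix (Fin 2) (Fin 2) K) (hB : B 1 0 = 0) (hB' : B 0 1 = 0)
    {m : ℕ} {q : MvPolynomial (Fin 2) K} (hq : q.IsHomogeneous m) {r : ℕ} (hr : r ≤ m) :
    coeff (Finsupp.single 0 r + Finsupp.single 1 (m - r)) (linSubst (Fin 2) K B q) = B 0 0 ^ r * B 1 1 ^ (m - r) * coeff (Finsupp.single 0 r + Finsupp.single 1 (m - r)) q := by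
  rw [bs_coeff_linSubst B hB hq hr, Finset.sum_range_succ, Finset.sum_eq_zero, zero_add]
  · simp
  · intro i hi
    rw [Finset.mem_range] at hi
    rw [hB', zero_pow (by omega)]
    ring

/-- Coefficient law for the SHEAR `x ↦ x - t y`:
`α_r(Sh(t) · q) = ∑_{i ≤ r} C(m-i, r-i) (-t)^{r-i} α_i(q)`. [folklore] -/
theorem bs_coeff_linSubst_shear (t : K) {m : ℕ} {q : MvPolynomial (Fin 2) K}
    (hq : q.IsHomogeneous m) {r : ℕ} (hr : r ≤ m) :
    coeff (Finsupp.single 0 r + Finsupp.single 1 (m - r)) (linSubst (Fin 2) K !![(1 : K), -t; 0, 1] q) =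
      ∑ i ∈ Finset.range (r + 1), ((m - i).choose (r - i) : K) * (-t) ^ (r - i) * coeff (Finsupp.single 0 i + Finsupp.single 1 (m - i)) q := by
  rw [bs_coeff_linSubst !![(1 : K), -t; 0, 1] (by simp) hq hr]
  refine Finset.sum_congr rfl fun i _ => ?_
  simp

/-! ## The Tschirnhaus normal form and its covariance -/

/-- **The Tschirnhaus polynomial is `(m α₀)^r` times the `r`-th coefficient of the normal form**
`N(q) = Sh(α₁/(m α₀)) · q` (for `α₀(q) ≠ 0`, `m ≠ 0` in `K`). [folklore] -/
theorem bs_tsch_eq {m : ℕ} {q : MvPolynomial (Fin 2) K} (hq : q.IsHomogeneous m) {r : ℕ} (hr : r ≤ m)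
    (h0 : coeff (Finsupp.single 0 0 + Finsupp.single 1 (m - 0)) q ≠ 0) (hm : ((m : ℕ) : K) ≠ 0) :
    (∑ i ∈ Finset.range (r + 1), ((Nat.choose (m - i) (r - i) : ℕ) : K) * (-(coeff (Finsupp.single 0 1 + Finsupp.single 1 (m - 1)) q)) ^ (r - i) * (((m : ℕ) : K) * coeff (Finsupp.single 0 0 + Finsupp.single 1 (m - 0)) q) ^ i * coeff (Finsupp.single 0 i + Finsupp.single 1 (m - i)) q) = (((m : ℕ) : K) * coeff (Finsupp.single 0 0 + Finsupp.single 1 (m - 0)) q) ^ r *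
      coeff (Finsupp.single 0 r + Finsupp.single 1 (m - r)) (linSubst (Fin 2) K !![(1 : K), -(coeff (Finsupp.single 0 1 + Finsupp.single 1 (m - 1)) q / (((m : ℕ) : K) * coeff (Finsupp.single 0 0 + Finsupp.single 1 (m - 0)) q)); 0, 1] q) := by
  rw [bs_coeff_linSubst_shear _ hq hr, Finset.mul_sum]
  refine Finset.sum_congr rfl fun i hi => ?_
  rw [Finset.mem_range] at hi
  have hma : ((m : ℕ) : K) * coeff (Finsupp.single 0 0 + Finsupp.single 1 (m - 0)) q ≠ 0 := mul_ne_zero hm h0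
  have hsplit : (((m : ℕ) : K) * coeff (Finsupp.single 0 0 + Finsupp.single 1 (m - 0)) q) ^ r =
      (((m : ℕ) : K) * coeff (Finsupp.single 0 0 + Finsupp.single 1 (m - 0)) q) ^ (r - i) * (((m : ℕ) : K) * coeff (Finsupp.single 0 0 + Finsupp.single 1 (m - 0)) q) ^ i := by
    rw [← pow_add]; congr 1; omega
  rw [hsplit]
  have hkey : (((m : ℕ) : K) * coeff (Finsupp.single 0 0 + Finsupp.single 1 (m - 0)) q) ^ (r - i) *
      (-(coeff (Finsupp.single 0 1 + Finsupp.single 1 (m - 1)) q / (((m : ℕ) : K) * coeff (Finsupp.single 0 0 + Finsupp.single 1 (m - 0)) q))) ^ (r - i) = (-(coeff (Finsupp.single 0 1 + Finsupp.single 1 (m - 1)) q)) ^ (r - i) := by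
    rw [← mul_pow]; congr 1; field_simp
  calc (((m : ℕ) - i).choose (r - i) : K) * (-(coeff (Finsupp.single 0 1 + Finsupp.single 1 (m - 1)) q)) ^ (r - i) *
        (((m : ℕ) : K) * coeff (Finsupp.single 0 0 + Finsupp.single 1 (m - 0)) q) ^ i * coeff (Finsupp.single 0 i + Finsupp.single 1 (m - i)) q
      = (((m : ℕ) - i).choose (r - i) : K) * ((((m : ℕ) : K) * coeff (Finsupp.single 0 0 + Finsupp.single 1 (m - 0)) q) ^ (r - i) *
          (-(coeff (Finsupp.single 0 1 + Finsupp.single 1 (m - 1)) q / (((m : ℕ) : K) * coeff (Finsupp.single 0 0 + Finsupp.single 1 (m - 0)) q))) ^ (r - i)) *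
          (((m : ℕ) : K) * coeff (Finsupp.single 0 0 + Finsupp.single 1 (m - 0)) q) ^ i * coeff (Finsupp.single 0 i + Finsupp.single 1 (m - i)) q := by rw [hkey]
    _ = _ := by ring

/-- **The shear–Borel matrix identity** `Sh((B₀₁ + B₀₀ t)/B₁₁) · B = diag(B₀₀, B₁₁) · Sh(t)` for `B` upper
triangular with `B₁₁ ≠ 0`. [folklore] -/
theorem bs_shear_mul (B : Matrix (Fin 2) (Fin 2) K) (hB : B 1 0 = 0) (h11 : B 1 1 ≠ 0) (t : K) :
    !![(1 : K), -((B 0 1 + B 0 0 * t) / B 1 1); 0, 1] * B = !![B 0 0, 0; 0, B 1 1] * !![(1 : K), -t; 0, 1] := by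
  ext i j
  fin_cases i <;> fin_cases j <;> simp [Matrix.mul_apply, Fin.sum_univ_two, hB]
  rw [div_mul_cancel₀ _ h11]
  ring

/-- The ratio killed by the normal form transforms affinely:
`α₁(Bq)/(m α₀(Bq)) = (B₀₁ + B₀₀ · α₁(q)/(m α₀(q)))/B₁₁`. [folklore] -/
theorem bs_ratio_linSubst (B : Matrix (Fin 2) (Fin 2) K) (hB : B 1 0 = 0) (h11 : B 1 1 ≠ 0) {m : ℕ}
    {q : MvPolynomial (Fin 2) K} (hq : q.IsHomogeneous m) (hm1 : 1 ≤ m)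
    (h0 : coeff (Finsupp.single 0 0 + Finsupp.single 1 (m - 0)) q ≠ 0) (hm : ((m : ℕ) : K) ≠ 0) :
    coeff (Finsupp.single 0 1 + Finsupp.single 1 (m - 1)) (linSubst (Fin 2) K B q) / (((m : ℕ) : K) * coeff (Finsupp.single 0 0 + Finsupp.single 1 (m - 0)) (linSubst (Fin 2) K B q)) =
      (B 0 1 + B 0 0 * (coeff (Finsupp.single 0 1 + Finsupp.single 1 (m - 1)) q / (((m : ℕ) : K) * coeff (Finsupp.single 0 0 + Finsupp.single 1 (m - 0)) q))) / B 1 1 := by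
  rw [bs_coeff_one_linSubst B hB hq hm1, bs_coeff_zero_linSubst B hB hq]
  obtain ⟨m', rfl⟩ : ∃ m', m = m' + 1 := ⟨m - 1, by omega⟩
  simp only [Nat.add_sub_cancel, pow_succ]
  have hp : B 1 1 ^ m' ≠ 0 := pow_ne_zero _ h11
  field_simp

/-- **Covariance of the Tschirnhaus normal form**: `N(B · q) = diag(B₀₀, B₁₁) · N(q)` for `B` upper
triangular with nonzero diagonal and `α₀(q) ≠ 0`. [folklore] -/
theorem bs_normalForm_linSubst (B : Matrix (Fin 2) (Fin 2) K) (hB : B 1 0 = 0) (h11 : B 1 1 ≠ 0)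
    {m : ℕ} {q : MvPolynomial (Fin 2) K} (hq : q.IsHomogeneous m) (hm1 : 1 ≤ m)
    (h0 : coeff (Finsupp.single 0 0 + Finsupp.single 1 (m - 0)) q ≠ 0) (hm : ((m : ℕ) : K) ≠ 0) :
    linSubst (Fin 2) K !![(1 : K), -(coeff (Finsupp.single 0 1 + Finsupp.single 1 (m - 1)) (linSubst (Fin 2) K B q) /
        (((m : ℕ) : K) * coeff (Finsupp.single 0 0 + Finsupp.single 1 (m - 0)) (linSubst (Fin 2) K B q))); 0, 1] (linSubst (Fin 2) K B q) =
      linSubst (Fin 2) K !![B 0 0, 0; 0, B 1 1]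
        (linSubst (Fin 2) K !![(1 : K), -(coeff (Finsupp.single 0 1 + Finsupp.single 1 (m - 1)) q / (((m : ℕ) : K) * coeff (Finsupp.single 0 0 + Finsupp.single 1 (m - 0)) q)); 0, 1] q) := by
  rw [bs_ratio_linSubst B hB h11 hq hm1 h0 hm, ← AlgHom.comp_apply, ← linSubst_mul,
    bs_shear_mul B hB h11, linSubst_mul, AlgHom.comp_apply]

/-- **Relative invariance of the Tschirnhaus polynomials.** For `B` upper triangular with nonzero
diagonal, `q` of degree `m ≥ 1` with `α₀(q) ≠ 0` (and `m ≠ 0` in `K`), and `r ≤ m`: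
`T_r(B · q) = B₁₁^{(m-1) r + m} B₀₀^r T_r(q)` — `T_r` is a seminvariant of degree `r + 1` and
weight `r`. [folklore; Elliott 1895 §128] -/
theorem bs_tsch_linSubst {K : Type*} [Field K] (B : Matrix (Fin 2) (Fin 2) K) (hB : B 1 0 = 0)
    (h11 : B 1 1 ≠ 0) {m : ℕ} {q : MvPolynomial (Fin 2) K} (hq : q.IsHomogeneous m) (hm1 : 1 ≤ m)
    (h0 : coeff (Finsupp.single 0 0 + Finsupp.single 1 (m - 0)) q ≠ 0) (hm : ((m : ℕ) : K) ≠ 0) {r : ℕ} (hr : r ≤ m) :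
    (∑ i ∈ Finset.range (r + 1), ((Nat.choose (m - i) (r - i) : ℕ) : K) * (-(coeff (Finsupp.single 0 1 + Finsupp.single 1 (m - 1)) (linSubst (Fin 2) K B q))) ^ (r - i) * (((m : ℕ) : K) * coeff (Finsupp.single 0 0 + Finsupp.single 1 (m - 0)) (linSubst (Fin 2) K B q)) ^ i * coeff (Finsupp.single 0 i + Finsupp.single 1 (m - i)) (linSubst (Fin 2) K B q)) = B 1 1 ^ ((m - 1) * r + m) * B 0 0 ^ r * (∑ i ∈ Finset.range (r + 1), ((Nat.choose (m - i) (r - i) : ℕ) : K) * (-(coeff (Finsupp.single 0 1 + Finsupp.single 1 (m - 1)) q)) ^ (r - i) * (((m : ℕ) : K) * coeff (Finsupp.single 0 0 + Finsupp.single 1 (m - 0)) q) ^ i * coeff (Finsupp.single 0 i + Finsupp.single 1 (m - i)) q) := by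
  have hBq : (linSubst (Fin 2) K B q).IsHomogeneous m := linSubst_isHomogeneous B hq
  have h0B : coeff (Finsupp.single 0 0 + Finsupp.single 1 (m - 0)) (linSubst (Fin 2) K B q) ≠ 0 := by
    rw [bs_coeff_zero_linSubst B hB hq]
    exact mul_ne_zero (pow_ne_zero _ h11) h0
  have hNq : (linSubst (Fin 2) K !![(1 : K), -(coeff (Finsupp.single 0 1 + Finsupp.single 1 (m - 1)) q / (((m : ℕ) : K) * coeff (Finsupp.single 0 0 + Finsupp.single 1 (m - 0)) q)); 0, 1] q).IsHomogeneous m :=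
    linSubst_isHomogeneous _ hq
  rw [bs_tsch_eq hBq hr h0B hm, bs_normalForm_linSubst B hB h11 hq hm1 h0 hm,
    bs_coeff_linSubst_of_diag _ (by simp) (by simp) hNq hr, bs_tsch_eq hq hr h0 hm,
    bs_coeff_zero_linSubst B hB hq]
  simp only [Matrix.of_apply, Matrix.cons_val', Matrix.cons_val_zero, Matrix.cons_val_one,
    Matrix.cons_val_fin_one]
  have e : (m - 1) * r + m = m * r + (m - r) := by
    obtain ⟨m', rfl⟩ : ∃ m', m = m' + 1 := ⟨m - 1, by omega⟩
    simp only [Nat.add_sub_cancel]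
    zify [hr]
    ring
  rw [e, pow_add, mul_pow, mul_pow, ← pow_mul]
  ring

end

end Summit.ValiantsHypothesis.ValiantsHypothesis.Theorems.ValuativeFlip
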